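import Mathlib
import HarnessLib
import Summits.ValiantsHypothesis.ValiantsHypothesis.Theorems.MonotoneRestorationOrbitRestorationQPUntwistedMatrixSymmetricProducts
import Summits.ValiantsHypothesis.ValiantsHypothesis.Theorems.MonotoneRestorationOrbitRestorationQPSupportBlocks

/-!
# Normalised factor families are exactly permuted (SPAN currency; units → exact permutation)

Route MonotoneRestoration, crux `OrbitRestorationQP` (stmt-ValiantsHypothesis-18293), SPAN-currency lane of the open
sub-rung A_∞ (`stub_sigmaPiSigmaValue`), `ΠΣ` part.  Helper (`--supports`), def-free.

The untwisted `ΠΣ` theorem `CorePatterns.prod_mem_narrowSpan_of_untwisted_matrixSymmetric` asks that every row/column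
renaming permute the factor family EXACTLY.  Unique factorisation only gives a permutation UP TO UNITS.  This file does
the bookkeeping "units → exact permutation":

* `exists_perm_of_map_univ_eq` — two finite families with the same multiset of values differ by a permutation of the
  index type (fibrewise bijections glued by `Equiv.ofFiberEquiv`);
* `map_eq_of_rel_associated_of_normaliser` — a multiset of polynomials that is matched up to associates with its image
  under a map `φ` is matched EXACTLY as soon as some functional `N`, `φ`-invariant and degree-one homogeneous under
  scalars, takes the value `1` on it (an INVARIANT NORMALISER);
* `exists_perm_rename_eq_of_normaliser` — hence a row/column renaming fixing `C a · Π_i L_i` (degree-one factors,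
  normalised by an invariant normaliser) permutes the family `L` exactly;
* `balancedNormaliser_*` — the normaliser "constant term if nonzero, else coefficient sum" is invariant under every
  renaming and degree-one homogeneous;
* **`prod_mem_narrowSpan_of_nonBalanced_matrixSymmetric`** — COROLLARY: a matrix-symmetric affine product
  `C a · Π_i L_i` (`|ι| < C(n,k)`, `8 < n`, `1 ≤ k`, `4k ≤ n`, nonzero) NONE of whose factors is BALANCED (zero constant
  term AND zero coefficient sum) lies in `span_ℂ {hom_{F,n} : tw F ≤ 2k − 1}` — polynomial orbits.  So a twist needs a
  balanced factor (such as `x_{aq} − x_{a'q}`): the twisted residue of the `ΠΣ` sub-rung in span currency consists of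
  families with balanced factors.

Honest label: bookkeeping for the span-currency lane of A_∞'s `ΠΣ` sub-rung; no registered stub is closed; the crux and
VP ≠ VNP are not moved. [folklore]
-/

noncomputable section

-- `Summit.ValiantsHypothesis.ValiantsHypothesis.…` is the tree's single-conjunct layout (Sub = Summit).
set_option linter.dupNamespace false

namespace Summit.ValiantsHypothesis.ValiantsHypothesis.Theorems

namespace NormalisedFactors

open MvPolynomial Finset Equiv ProductAction
open Literature.Computability.AlgebraicComplexity (homPoly)
open Literature.Combinatorics.SimpleGraph (treewidth)

variable {n : ℕ}

/-! ### Families with equal value multisets differ by a permutation -/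

/-- **Two finite families with the same multiset of values differ by a permutation of the indices.** [folklore] -/
theorem exists_perm_of_map_univ_eq {ι α : Type*} [Fintype ι] (F G : ι → α)
    (h : (univ : Finset ι).val.map F = (univ : Finset ι).val.map G) :
    ∃ κ : Perm ι, ∀ i, F i = G (κ i) := by
  classical
  have key : ∀ (H : ι → α) (c : α),
      Fintype.card {i // H i = c} = Multiset.count c ((univ : Finset ι).val.map H) := by
    intro H c
    rw [Fintype.card_subtype, Multiset.count_map, Finset.card_def, Finset.filter_val]
    congr 1
    exact Multiset.filter_congr fun i _ => eq_comm
  have hcard : ∀ c : α, Fintype.card {i // F i = c} = Fintype.card {i // G i = c} := by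
    intro c
    rw [key, key, h]
  refine ⟨Equiv.ofFiberEquiv (f := F) (g := G) fun c => Fintype.equivOfCardEq (hcard c), fun i => ?_⟩
  exact (Equiv.ofFiberEquiv_map (f := F) (g := G) (fun c => Fintype.equivOfCardEq (hcard c)) i).symm

/-! ### Invariant normalisers turn "permuted up to units" into "permuted" -/

/-- **An invariant normaliser upgrades a matching up to associates to an exact matching.**  If the multisets
`M.map φ` and `M` have the same associates, and a functional `N` satisfies `N (φ p) = N p`, `N (C u * p) = u * N p`
and `N p = 1` on `M`, then `M.map φ = M`. [folklore] -/
theorem map_eq_of_rel_associated_of_normaliser (M : Multiset (MvPolynomial (Fin n × Fin n) ℂ))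
    (φ : MvPolynomial (Fin n × Fin n) ℂ → MvPolynomial (Fin n × Fin n) ℂ)
    (hrel : Multiset.Rel Associated (M.map φ) M) (N : MvPolynomial (Fin n × Fin n) ℂ → ℂ)
    (hNφ : ∀ p ∈ M, N (φ p) = N p) (hNsmul : ∀ (u : ℂ), ∀ p ∈ M, N (C u * p) = u * N p)
    (hNM : ∀ p ∈ M, N p = 1) : M.map φ = M := by
  refine Multiset.rel_eq.1 (hrel.mono fun x hx y hy hxy => ?_)
  obtain ⟨p, hp, rfl⟩ := Multiset.mem_map.1 hx
  obtain ⟨c, -, hc⟩ := SupportBlocks.exists_C_of_associated hxy.symm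
  -- `φ p = C c * y`; apply the normaliser
  have h1 : N (φ p) = 1 := by rw [hNφ p hp, hNM p hp]
  have h2 : N (C c * y) = c := by rw [hNsmul c y hy, hNM y hy, mul_one]
  rw [hc] at h1
  rw [h1] at h2
  rw [hc, ← h2, C_1, one_mul]

/-- The independent row/column renaming preserves the total degree. [folklore] -/
theorem totalDegree_rename_rowCol (σ τ : Perm (Fin n)) (p : MvPolynomial (Fin n × Fin n) ℂ) :
    (rename (fun P : Fin n × Fin n => (σ P.1, τ P.2)) p).totalDegree = p.totalDegree := by
  refine le_antisymm (totalDegree_rename_le _ _) ?_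
  have hcomp : (fun P : Fin n × Fin n => (σ⁻¹ P.1, τ⁻¹ P.2)) ∘ (fun P : Fin n × Fin n => (σ P.1, τ P.2)) = id := by
    funext P
    simp
  have h := totalDegree_rename_le (f := fun P : Fin n × Fin n => (σ⁻¹ P.1, τ⁻¹ P.2))
    (rename (fun P : Fin n × Fin n => (σ P.1, τ P.2)) p)
  rwa [rename_rename, hcomp, rename_id] at h

/-- **A renaming fixing a product of degree-one factors permutes the factors up to associates** (unique
factorisation), multiset form. [folklore] -/
theorem rel_associated_of_rename_prod_eq {ι : Type} [Fintype ι] (L : ι → MvPolynomial (Fin n × Fin n) ℂ) (a : ℂ)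
    (hL1 : ∀ i, (L i).totalDegree = 1) (hf0 : C a * ∏ i, L i ≠ 0) (σ τ : Perm (Fin n))
    (hfix : rename (fun P : Fin n × Fin n => (σ P.1, τ P.2)) (C a * ∏ i, L i) = C a * ∏ i, L i) :
    Multiset.Rel Associated
      (((univ : Finset ι).val.map L).map (rename (fun P : Fin n × Fin n => (σ P.1, τ P.2)))) ((univ : Finset ι).val.map L) := by
  classical
  set φ : MvPolynomial (Fin n × Fin n) ℂ →ₐ[ℂ] MvPolynomial (Fin n × Fin n) ℂ :=
    rename (fun P : Fin n × Fin n => (σ P.1, τ P.2)) with hφ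
  have ha0 : a ≠ 0 := by
    rintro rfl
    exact hf0 (by rw [C_0, zero_mul])
  have hCa : (C a : MvPolynomial (Fin n × Fin n) ℂ) ≠ 0 := fun h => ha0 ((C_eq_zero).1 h)
  have hA : ∀ x ∈ ((univ : Finset ι).val.map L).map φ, Irreducible x := by
    intro x hx
    obtain ⟨y, hy, rfl⟩ := Multiset.mem_map.1 hx
    obtain ⟨i, -, rfl⟩ := Multiset.mem_map.1 hy
    exact AffineFactors.irreducible_of_totalDegree_eq_one (by rw [hφ, totalDegree_rename_rowCol, hL1 i])
  have hB : ∀ x ∈ (univ : Finset ι).val.map L, Irreducible x := by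
    intro x hx
    obtain ⟨i, -, rfl⟩ := Multiset.mem_map.1 hx
    exact AffineFactors.irreducible_of_totalDegree_eq_one (hL1 i)
  have hprodφ : φ (∏ i, L i) = ∏ i, L i := by
    have h := hfix
    rw [map_mul, hφ, rename_C] at h
    exact mul_left_cancel₀ hCa h
  have hprod : (((univ : Finset ι).val.map L).map φ).prod = ((univ : Finset ι).val.map L).prod := by
    rw [Multiset.map_map, ← Finset.prod_eq_multiset_prod, ← Finset.prod_eq_multiset_prod]
    have h2 : (∏ i, (⇑φ ∘ L) i) = φ (∏ i, L i) := by rw [map_prod]; rfl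
    rw [h2, hprodφ]
  exact UniqueFactorizationMonoid.factors_unique hA hB (hprod ▸ Associated.refl _)

/-- **UNITS → EXACT PERMUTATION.**  Let `C a · Π_i L_i ≠ 0` (degree-one factors) be fixed by the renaming
`(p, q) ↦ (σ p, τ q)`, and let `N` be a functional with `N ((σ,τ) · L_i) = N (L_i)`, `N (C u · L_i) = u · N (L_i)` and
`N (L_i) = 1` for all `i` (an invariant normaliser taking the value `1` on the family).  Then the renaming permutes the
family EXACTLY: `(σ,τ) · L_i = L_{κ i}` for a permutation `κ` of the indices. [folklore] -/
theorem exists_perm_rename_eq_of_normaliser {ι : Type} [Fintype ι] (L : ι → MvPolynomial (Fin n × Fin n) ℂ) (a : ℂ)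
    (hL1 : ∀ i, (L i).totalDegree = 1) (hf0 : C a * ∏ i, L i ≠ 0) (σ τ : Perm (Fin n))
    (hfix : rename (fun P : Fin n × Fin n => (σ P.1, τ P.2)) (C a * ∏ i, L i) = C a * ∏ i, L i)
    (N : MvPolynomial (Fin n × Fin n) ℂ → ℂ)
    (hNren : ∀ i, N (rename (fun P : Fin n × Fin n => (σ P.1, τ P.2)) (L i)) = N (L i))
    (hNsmul : ∀ (u : ℂ) (i : ι), N (C u * L i) = u * N (L i)) (hNL : ∀ i, N (L i) = 1) :
    ∃ κ : Perm ι, ∀ i, rename (fun P : Fin n × Fin n => (σ P.1, τ P.2)) (L i) = L (κ i) := by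
  classical
  have hrel := rel_associated_of_rename_prod_eq L a hL1 hf0 σ τ hfix
  have hM : ((univ : Finset ι).val.map L).map (rename (fun P : Fin n × Fin n => (σ P.1, τ P.2))) =
      (univ : Finset ι).val.map L := by
    refine map_eq_of_rel_associated_of_normaliser _ _ hrel N ?_ ?_ ?_
    · intro p hp
      obtain ⟨i, -, rfl⟩ := Multiset.mem_map.1 hp
      exact hNren i
    · intro u p hp
      obtain ⟨i, -, rfl⟩ := Multiset.mem_map.1 hp
      exact hNsmul u i
    · intro p hp
      obtain ⟨i, -, rfl⟩ := Multiset.mem_map.1 hp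
      exact hNL i
  rw [Multiset.map_map] at hM
  exact exists_perm_of_map_univ_eq (fun i => rename (fun P : Fin n × Fin n => (σ P.1, τ P.2)) (L i)) L hM

/-! ### The normaliser "constant term, else coefficient sum" -/

/-- The constant term is invariant under the row/column renaming. [folklore] -/
theorem constantCoeff_rename_rowCol (σ τ : Perm (Fin n)) (p : MvPolynomial (Fin n × Fin n) ℂ) :
    constantCoeff (rename (fun P : Fin n × Fin n => (σ P.1, τ P.2)) p) = constantCoeff p :=
  constantCoeff_rename _ _

/-- The coefficient sum (value at the all-ones matrix) is invariant under the row/column renaming. [folklore] -/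
theorem eval_one_rename_rowCol (σ τ : Perm (Fin n)) (p : MvPolynomial (Fin n × Fin n) ℂ) :
    eval (fun _ => (1 : ℂ)) (rename (fun P : Fin n × Fin n => (σ P.1, τ P.2)) p) = eval (fun _ => (1 : ℂ)) p := by
  rw [eval_rename]
  rfl

/-- **The balanced normaliser is degree-one homogeneous**: with
`N p = if constantCoeff p ≠ 0 then constantCoeff p else eval 1 p`, `N (C u * p) = u * N p`. [folklore] -/
theorem balancedNormaliser_smul (u : ℂ) (p : MvPolynomial (Fin n × Fin n) ℂ) :
    (if constantCoeff (C u * p) ≠ 0 then constantCoeff (C u * p) else eval (fun _ => (1 : ℂ)) (C u * p)) =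
      u * (if constantCoeff p ≠ 0 then constantCoeff p else eval (fun _ => (1 : ℂ)) p) := by
  have hcc : constantCoeff (C u * p) = u * constantCoeff p := by rw [map_mul, constantCoeff_C]
  have hev : eval (fun _ => (1 : ℂ)) (C u * p) = u * eval (fun _ => (1 : ℂ)) p := by rw [map_mul, eval_C]
  rw [hcc, hev]
  by_cases hu : u = 0
  · subst hu
    simp
  · by_cases hp : constantCoeff p = 0
    · simp [hp]
    · have : u * constantCoeff p ≠ 0 := mul_ne_zero hu hp
      simp [hp, this]

/-- **The balanced normaliser is invariant under the row/column renaming.** [folklore] -/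
theorem balancedNormaliser_rename (σ τ : Perm (Fin n)) (p : MvPolynomial (Fin n × Fin n) ℂ) :
    (if constantCoeff (rename (fun P : Fin n × Fin n => (σ P.1, τ P.2)) p) ≠ 0 then
        constantCoeff (rename (fun P : Fin n × Fin n => (σ P.1, τ P.2)) p) else
        eval (fun _ => (1 : ℂ)) (rename (fun P : Fin n × Fin n => (σ P.1, τ P.2)) p)) =
      (if constantCoeff p ≠ 0 then constantCoeff p else eval (fun _ => (1 : ℂ)) p) := by
  rw [constantCoeff_rename_rowCol, eval_one_rename_rowCol]

/-! ### Corollary: no balanced factor ⇒ untwisted ⇒ constant treewidth -/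

/-- Rescaling a degree-one polynomial by a nonzero constant keeps the degree. [folklore] -/
theorem totalDegree_C_mul_of_ne_zero {u : ℂ} (hu : u ≠ 0) {p : MvPolynomial (Fin n × Fin n) ℂ} (hp : p ≠ 0) :
    (C u * p).totalDegree = p.totalDegree := by
  have hCu : (C u : MvPolynomial (Fin n × Fin n) ℂ) ≠ 0 := fun h => hu ((C_eq_zero).1 h)
  rw [totalDegree_mul_of_isDomain hCu hp, totalDegree_C, zero_add]

/-- **NO BALANCED FACTOR ⇒ POLYNOMIAL ORBITS (span currency).**  Let `f = C a · Π_i L_i ≠ 0` (`|ι| < C(n,k)` affine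
factors, `8 < n`, `1 ≤ k`, `4k ≤ n`) be invariant under all row and all column permutations, and suppose NO factor is
balanced: every `L_i` has a nonzero constant term or a nonzero coefficient sum.  Then
`f ∈ span_ℂ {hom_{F,n} : tw F ≤ 2k − 1}`.  Proof: absorb the constant factors, rescale every other factor by the
balanced normaliser (an invariant degree-one functional, nonzero on the family by hypothesis); the rescaled family is
then EXACTLY permuted (`exists_perm_rename_eq_of_normaliser`) and the untwisted `ΠΣ` theorem applies.
[folklore; cite: DwivediPagoSeppelt2026, §8; DixonMortimer1996, Thm 5.2B] -/
theorem prod_mem_narrowSpan_of_nonBalanced_matrixSymmetric {k : ℕ} (hn : 8 < n) (hk : 1 ≤ k) (h4k : 4 * k ≤ n)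
    {ι : Type} [Fintype ι] (L : ι → MvPolynomial (Fin n × Fin n) ℂ) (a : ℂ)
    (hL : ∀ i, (L i).totalDegree ≤ 1) (hcard : Fintype.card ι < n.choose k) (hf0 : C a * ∏ i, L i ≠ 0)
    (hrow : ∀ σ : Perm (Fin n), vact (K := ℂ) rowHom σ (C a * ∏ i, L i) = C a * ∏ i, L i)
    (hcol : ∀ τ : Perm (Fin n), vact (K := ℂ) colHom τ (C a * ∏ i, L i) = C a * ∏ i, L i)
    (hnb : ∀ i, constantCoeff (L i) ≠ 0 ∨ eval (fun _ => (1 : ℂ)) (L i) ≠ 0) :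
    (C a * ∏ i, L i) ∈ Submodule.span ℂ {p : MvPolynomial (Fin n × Fin n) ℂ |
        ∃ (a b : ℕ) (E : Multiset (Fin a × Fin b)),
          treewidth (SimpleGraph.fromRel fun u v : Fin a ⊕ Fin b =>
            ∃ e ∈ E, u = Sum.inl e.1 ∧ v = Sum.inr e.2) ≤ 2 * k - 1 ∧ p = homPoly E n ℂ} := by
  classical
  -- the normaliser
  set N : MvPolynomial (Fin n × Fin n) ℂ → ℂ := fun p =>
    if constantCoeff p ≠ 0 then constantCoeff p else eval (fun _ => (1 : ℂ)) p with hN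
  have hN0 : ∀ i, N (L i) ≠ 0 := by
    intro i
    simp only [hN]
    split_ifs with h
    · exact h
    · exact (hnb i).resolve_left h
  have hLi0 : ∀ i, L i ≠ 0 := by
    intro i h
    exact hf0 (by rw [Finset.prod_eq_zero (Finset.mem_univ i) h, mul_zero])
  -- degree-one indices and constant indices
  set P : ι → Prop := fun i => (L i).totalDegree = 1 with hP
  have hconst : ∀ i, ¬ P i → L i = C (constantCoeff (L i)) := by
    intro i hi
    have h0 : (L i).totalDegree = 0 := by have := hL i; simp only [hP] at hi; omega
    rw [constantCoeff_eq]  -- constantCoeff = coeff 0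
    exact (totalDegree_eq_zero_iff_eq_C (p := L i)).1 h0
  -- the rescaled degree-one family
  set ι₁ := {i // P i} with hι₁
  set L' : ι₁ → MvPolynomial (Fin n × Fin n) ℂ := fun i => C (N (L i))⁻¹ * L i with hL'
  set b : ℂ := ∏ i : {i // ¬ P i}, constantCoeff (L i) with hb
  set u : ℂ := ∏ i : ι₁, N (L i) with hu
  have hu0 : u ≠ 0 := Finset.prod_ne_zero_iff.2 fun i _ => hN0 i
  -- f = C (a * b * u) * Π L'
  have hsplit : (∏ i, L i) = (∏ i : ι₁, L (i : ι)) * C b := by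
    rw [← Fintype.prod_subtype_mul_prod_subtype P L, hb, map_prod]
    congr 1
    exact Finset.prod_congr rfl fun i _ => hconst i i.2
  have hL'prod : (∏ i : ι₁, L (i : ι)) = C u * ∏ i : ι₁, L' i := by
    have h1 : (∏ i : ι₁, L' i) = C u⁻¹ * ∏ i : ι₁, L (i : ι) := by
      rw [hL', Finset.prod_mul_distrib, ← map_prod, Finset.prod_inv_distrib, ← hu]
    rw [h1, ← mul_assoc, ← map_mul, mul_inv_cancel₀ hu0, C_1, one_mul]
  have hf : C a * ∏ i, L i = C (a * b * u) * ∏ i : ι₁, L' i := by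
    rw [hsplit, hL'prod, map_mul, map_mul]
    ring
  -- hypotheses of the untwisted theorem for `L'`
  have hL'1 : ∀ i : ι₁, (L' i).totalDegree = 1 := by
    intro i
    rw [hL', totalDegree_C_mul_of_ne_zero (inv_ne_zero (hN0 i)) (hLi0 i)]
    exact i.2
  have hcard' : Fintype.card ι₁ < n.choose k := (Fintype.card_subtype_le P).trans_lt hcard
  have hf0' : C (a * b * u) * ∏ i : ι₁, L' i ≠ 0 := by rwa [← hf]
  have hrow' : ∀ σ : Perm (Fin n), vact (K := ℂ) rowHom σ (C (a * b * u) * ∏ i : ι₁, L' i) =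
      C (a * b * u) * ∏ i : ι₁, L' i := by intro σ; rw [← hf]; exact hrow σ
  have hcol' : ∀ τ : Perm (Fin n), vact (K := ℂ) colHom τ (C (a * b * u) * ∏ i : ι₁, L' i) =
      C (a * b * u) * ∏ i : ι₁, L' i := by intro τ; rw [← hf]; exact hcol τ
  have hNL' : ∀ i : ι₁, N (L' i) = 1 := by
    intro i
    have h := balancedNormaliser_smul (n := n) (N (L i))⁻¹ (L i)
    simp only [hN, hL'] at h ⊢
    rw [h, inv_mul_cancel₀ (hN0 i)]
  have huntwisted : ∀ σ τ : Perm (Fin n), ∃ κ : Perm ι₁, ∀ i,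
      rename (fun P : Fin n × Fin n => (σ P.1, τ P.2)) (L' i) = L' (κ i) := by
    intro σ τ
    refine exists_perm_rename_eq_of_normaliser L' (a * b * u) hL'1 hf0' σ τ ?_ N ?_ ?_ hNL'
    · rw [rename_prod_eq, hcol' τ, hrow' σ]
    · intro i
      exact balancedNormaliser_rename σ τ (L' i)
    · intro v i
      exact balancedNormaliser_smul v (L' i)
  rw [hf]
  exact CorePatterns.prod_mem_narrowSpan_of_untwisted_matrixSymmetric hn hk h4k L' (a * b * u)
    (fun i => (hL'1 i).le) hcard' hf0' hrow' hcol' huntwisted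

end NormalisedFactors

end Summit.ValiantsHypothesis.ValiantsHypothesis.Theorems

end
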